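import Mathlib
import Summits.NavierStokesRegularity.NavierStokesRegularity.Theorems.LandauTailLandauTailBlowupVitaliLp

/-!
# Crux `LandauTail.LandauTailBlowup` (stmt-NavierStokesRegularity-1944), line `registered`, cycle c6:
  preparations for the Reynolds-stress defect identity

Helper file (lead c6) serving the registered stub `landauTail_reynolds_defect_tendsto`
(`LandauTailLandauTailBlowupReynoldsDefect.lean`): the two estimates on the LINEAR part of the split
`F(u) − F(U) = ⟪w,∂ₜψ⟫ + ⟪w,(U·∇)ψ⟫ + ⟪U,(w·∇)ψ⟫ + ⟪w,Δψ⟫ + ⟪w,(w·∇)ψ⟫`, `w = u − U`: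

* `landauTail_norm_linear_part_le` (registered helper stub) — pointwise,
  `|⟪w,d⟫ + ⟪w, D b⟫ + ⟪b, D w⟫ + ⟪w, L⟫| ≤ 2M₀|w| + 2M₀|b||w|` for test data of norm `≤ M₀`;
* `landauTail_linear_terms_tendsto_zero` (registered helper stub) — on `S = (s₁,s₂) × B_ρ`, for deviations `w n`
  bounded in `L²(S)` and tending to `0` a.e., and `V ∈ L^{5/2}(B₁)`:
  `M ∫_S |w n| + M ∫_S |V||w n| → 0` (Vitali at exponents `1` and `5/3`, `landauTail_tendsto_eLpNorm_of_eLpNorm_le`,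
  and Hölder `(5/2, 5/3)`).
-/

set_option linter.dupNamespace false

noncomputable section

open MeasureTheory Set Function Filter Metric TopologicalSpace InnerProductSpace
open scoped NNReal ENNReal Topology RealInnerProductSpace

namespace Summit.NavierStokesRegularity.NavierStokesRegularity.Theorems

/-- **Pointwise bound on the linear part of the split** (registered helper stub of crux stmt-NavierStokesRegularity-1944):
with test data `d`, `D`, `L` of norm `≤ M₀`,
`‖⟪w, d⟫ + ⟪w, D b⟫ + ⟪b, D w⟫ + 1·⟪w, L⟫‖ ≤ 2M₀‖w‖ + 2M₀‖b‖‖w‖`. [folklore] -/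
theorem landauTail_norm_linear_part_le : ∀ (w b d L : EuclideanSpace ℝ (Fin 3)) (D : EuclideanSpace ℝ (Fin 3) →L[ℝ] EuclideanSpace ℝ (Fin 3)) (M₀ : ℝ), ‖d‖ ≤ M₀ → ‖D‖ ≤ M₀ → ‖L‖ ≤ M₀ → ‖inner ℝ w d + inner ℝ w (D b) + inner ℝ b (D w) + 1 * inner ℝ w L‖ ≤ 2 * M₀ * ‖w‖ + 2 * M₀ * (‖b‖ * ‖w‖) := by
  intro w b d L D M₀ h1 h2 h3
  have e1 : ‖⟪w, d⟫‖ ≤ ‖w‖ * M₀ := (norm_inner_le_norm _ _).trans (mul_le_mul_of_nonneg_left h1 (norm_nonneg _))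
  have e2 : ‖⟪w, D b⟫‖ ≤ ‖w‖ * (M₀ * ‖b‖) := by
    refine (norm_inner_le_norm _ _).trans (mul_le_mul_of_nonneg_left ?_ (norm_nonneg _))
    exact (D.le_opNorm _).trans (mul_le_mul_of_nonneg_right h2 (norm_nonneg _))
  have e3 : ‖⟪b, D w⟫‖ ≤ ‖b‖ * (M₀ * ‖w‖) := by
    refine (norm_inner_le_norm _ _).trans (mul_le_mul_of_nonneg_left ?_ (norm_nonneg _))
    exact (D.le_opNorm _).trans (mul_le_mul_of_nonneg_right h2 (norm_nonneg _))
  have e4 : ‖1 * ⟪w, L⟫‖ ≤ ‖w‖ * M₀ := by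
    rw [one_mul]
    exact (norm_inner_le_norm _ _).trans (mul_le_mul_of_nonneg_left h3 (norm_nonneg _))
  refine ((norm_add_le _ _).trans (add_le_add ((norm_add_le _ _).trans
    (add_le_add ((norm_add_le _ _).trans (add_le_add e1 e2)) e3)) e4)).trans (le_of_eq ?_)
  ring

/-- **The linear terms vanish in the limit** (registered helper stub of crux stmt-NavierStokesRegularity-1944): on
`S = (s₁,s₂) × B_ρ` (`ρ ≤ 1`), if the deviations `w n` are a.e.-strongly measurable, bounded in `L²(S)` and tend to
`0` a.e. on `S`, and `V ∈ L^{5/2}(B₁)` is measurable, then `M ∫_S |w n| + M ∫_S |V| |w n| → 0` (Vitali at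
exponents `1` and `5/3 < 2`; Hölder `(5/2, 5/3)` against `V`). [folklore] -/
theorem landauTail_linear_terms_tendsto_zero : ∀ (w : ℕ → ℝ × EuclideanSpace ℝ (Fin 3) → EuclideanSpace ℝ (Fin 3)) (V : EuclideanSpace ℝ (Fin 3) → EuclideanSpace ℝ (Fin 3)) (s₁ s₂ ρ M : ℝ) (C : NNReal), ρ ≤ 1 → MeasureTheory.AEStronglyMeasurable V MeasureTheory.volume → MeasureTheory.eLpNorm V (5 / 2) (MeasureTheory.volume.restrict (Metric.ball (0 : EuclideanSpace ℝ (Fin 3)) 1)) < ⊤ → (∀ n, MeasureTheory.AEStronglyMeasurable (w n) (MeasureTheory.volume.restrict (Set.Ioo s₁ s₂ ×ˢ Metric.ball (0 : EuclideanSpace ℝ (Fin 3)) ρ))) → (∀ n, MeasureTheory.eLpNorm (w n) 2 (MeasureTheory.volume.restrict (Set.Ioo s₁ s₂ ×ˢ Metric.ball (0 : EuclideanSpace ℝ (Fin 3)) ρ)) ≤ C) → (∀ᵐ z ∂(MeasureTheory.volume.restrict (Set.Ioo s₁ s₂ ×ˢ Metric.ball (0 : EuclideanSpace ℝ (Fin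 3)) ρ)), Filter.Tendsto (fun n => w n z) Filter.atTop (nhds 0)) → Filter.Tendsto (fun n => ENNReal.ofReal M * (∫⁻ z in Set.Ioo s₁ s₂ ×ˢ Metric.ball (0 : EuclideanSpace ℝ (Fin 3)) ρ, ‖w n z‖ₑ) + ENNReal.ofReal M * ∫⁻ z in Set.Ioo s₁ s₂ ×ˢ Metric.ball (0 : EuclideanSpace ℝ (Fin 3)) ρ, ‖V z.2‖ₑ * ‖w n z‖ₑ) Filter.atTop (nhds 0) := by
  intro w V s₁ s₂ ρ M C hρ1 hVm hV52 hwm hbd hae0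
  set S : Set (ℝ × EuclideanSpace ℝ (Fin 3)) := Ioo s₁ s₂ ×ˢ ball (0 : EuclideanSpace ℝ (Fin 3)) ρ with hSdef
  set μS : Measure (ℝ × EuclideanSpace ℝ (Fin 3)) := volume.restrict S with hμS
  haveI : IsFiniteMeasure μS := by
    refine ⟨?_⟩
    rw [hμS, Measure.restrict_apply_univ, hSdef, Measure.volume_eq_prod, Measure.prod_prod, Real.volume_Ioo]
    exact ENNReal.mul_lt_top ENNReal.ofReal_lt_top measure_ball_lt_top
  have hVm2 : AEStronglyMeasurable (fun z : ℝ × EuclideanSpace ℝ (Fin 3) => V z.2) μS := by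
    rw [hμS, Measure.volume_eq_prod]; exact hVm.comp_snd.restrict
  have hbd' : ∃ C' : ℝ≥0, ∀ n, eLpNorm (w n) 2 μS ≤ C' := ⟨C, hbd⟩
  -- Vitali at exponent `1`
  have hT₁0 : Tendsto (fun n => ∫⁻ z in S, ‖w n z‖ₑ) atTop (𝓝 0) := by
    have h := landauTail_tendsto_eLpNorm_of_eLpNorm_le μS w 0 1 2 le_rfl (by norm_num)
      ENNReal.ofNat_ne_top hwm hbd' hae0
    refine h.congr' (Eventually.of_forall fun n => ?_)
    rw [sub_zero, eLpNorm_one_eq_lintegral_enorm]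
  -- Vitali at exponent `5/3`
  set p₀ : ℝ≥0∞ := ENNReal.ofReal (5 / 3) with hp₀
  have hp₀1 : 1 ≤ p₀ := ENNReal.one_le_ofReal.2 (by norm_num)
  have hp₀2 : p₀ < 2 := by
    rw [hp₀, show (2 : ℝ≥0∞) = ENNReal.ofReal 2 by simp]
    exact (ENNReal.ofReal_lt_ofReal_iff two_pos).2 (by norm_num)
  have hp₀0 : p₀ ≠ 0 := (zero_lt_one.trans_le hp₀1).ne'
  have hp₀r : p₀.toReal = 5 / 3 := ENNReal.toReal_ofReal (by norm_num)
  have hwp₀ : Tendsto (fun n => eLpNorm (w n) p₀ μS) atTop (𝓝 0) := by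
    have h := landauTail_tendsto_eLpNorm_of_eLpNorm_le μS w 0 p₀ 2 hp₀1 hp₀2 ENNReal.ofNat_ne_top hwm hbd' hae0
    exact h.congr' (Eventually.of_forall fun n => by rw [sub_zero])
  -- `V ∈ L^{5/2}(S)` and Hölder
  set NU52 : ℝ≥0∞ := (∫⁻ z in S, ‖V z.2‖ₑ ^ (5 / 2 : ℝ)) ^ (1 / (5 / 2 : ℝ)) with hNU52
  have hNU52top : NU52 ≠ ⊤ := by
    have hU52' : ∫⁻ x in ball (0 : EuclideanSpace ℝ (Fin 3)) 1, ‖V x‖ₑ ^ (5 / 2 : ℝ) < ⊤ := by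
      have h0 : (5 / 2 : ℝ≥0∞) ≠ 0 := by simp
      have htop : (5 / 2 : ℝ≥0∞) ≠ ⊤ := by rw [Ne, ENNReal.div_eq_top]; simp
      have hr : (5 / 2 : ℝ≥0∞).toReal = 5 / 2 := by rw [ENNReal.toReal_div]; simp
      have h := lintegral_rpow_enorm_lt_top_of_eLpNorm_lt_top h0 htop hV52
      rwa [hr] at h
    refine ENNReal.rpow_ne_top_of_nonneg (by norm_num) (lt_top_iff_ne_top.1 ?_)
    have hprod : ∫⁻ z in S, ‖V z.2‖ₑ ^ (5 / 2 : ℝ) =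
        volume (Ioo s₁ s₂) * ∫⁻ x in ball (0 : EuclideanSpace ℝ (Fin 3)) ρ, ‖V x‖ₑ ^ (5 / 2 : ℝ) := by
      rw [hSdef, Measure.volume_eq_prod, ← Measure.prod_restrict]
      have e : (fun z : ℝ × EuclideanSpace ℝ (Fin 3) => ‖V z.2‖ₑ ^ (5 / 2 : ℝ)) =
          fun z => (fun _ : ℝ => (1 : ℝ≥0∞)) z.1 * (fun x => ‖V x‖ₑ ^ (5 / 2 : ℝ)) z.2 := by
        funext z; simp only [one_mul]
      rw [e, lintegral_prod_mul aemeasurable_const (hVm.restrict.enorm.pow_const _), lintegral_const,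
        Measure.restrict_apply_univ, one_mul]
    rw [hprod, Real.volume_Ioo]
    exact ENNReal.mul_lt_top ENNReal.ofReal_lt_top
      (lt_of_le_of_lt (lintegral_mono_set (ball_subset_ball hρ1)) hU52')
  have hT₂le : ∀ n, ∫⁻ z in S, ‖V z.2‖ₑ * ‖w n z‖ₑ ≤ NU52 * eLpNorm (w n) p₀ μS := by
    intro n
    have hpq : Real.HolderConjugate (5 / 2) (5 / 3) := by rw [Real.holderConjugate_iff]; norm_num
    have h := ENNReal.lintegral_mul_le_Lp_mul_Lq μS hpq hVm2.enorm (hwm n).enorm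
    rw [eLpNorm_eq_lintegral_rpow_enorm_toReal hp₀0 ENNReal.ofReal_ne_top, hp₀r]
    simpa only [Pi.mul_apply] using h
  -- assemble
  have h1 : Tendsto (fun n => ENNReal.ofReal M * ∫⁻ z in S, ‖w n z‖ₑ) atTop (𝓝 0) := by
    have h := ENNReal.Tendsto.const_mul (a := ENNReal.ofReal M) hT₁0 (Or.inr ENNReal.ofReal_ne_top)
    rwa [mul_zero] at h
  have h2 : Tendsto (fun n => NU52 * eLpNorm (w n) p₀ μS) atTop (𝓝 0) := by
    have h := ENNReal.Tendsto.const_mul (a := NU52) hwp₀ (Or.inr hNU52top)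
    rwa [mul_zero] at h
  have h3 : Tendsto (fun n => ENNReal.ofReal M * (NU52 * eLpNorm (w n) p₀ μS)) atTop (𝓝 0) := by
    have h := ENNReal.Tendsto.const_mul (a := ENNReal.ofReal M) h2 (Or.inr ENNReal.ofReal_ne_top)
    rwa [mul_zero] at h
  have h := h1.add h3
  rw [add_zero] at h
  refine tendsto_of_tendsto_of_tendsto_of_le_of_le tendsto_const_nhds h (fun _ => zero_le) fun n => ?_
  dsimp only
  gcongr
  exact hT₂le n

end Summit.NavierStokesRegularity.NavierStokesRegularity.Theorems

end
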